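import Mathlib
import Literature.NumberTheory.LFunctions.Zhang2022.SkeletonPropositions
import Literature.NumberTheory.LFunctions.Zhang2022.Section4GaussianWeight
import Literature.NumberTheory.LFunctions.Zhang2022.Section5DeltaAnalytic
import Literature.NumberTheory.LFunctions.Zhang2022.Section5DeltaMellin
import Literature.NumberTheory.LFunctions.Zhang2022.Section5ExceptionalZero
import Literature.NumberTheory.LFunctions.Zhang2022.Section5Lemma56Printed
import Literature.NumberTheory.LFunctions.Zhang2022.Section5Lemma58
import HarnessLib

/-!
# Zhang (2022), typed skeleton VI: Part I nodes, continued — §5 (Lemmas 5.1–5.6, 5.8, 5.9) and §6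
# (the approximate formula for `L(s,ψ)`: `K`, `N`, `E₁`, Lemma 6.1)

Topic `Literature/NumberTheory/LFunctions/Zhang2022` (Landau–Siegel audit tree; verdict-neutral).
Y. Zhang, *Discrete mean estimates and the Landau–Siegel zero*, arXiv:2211.02515v1 (2022)
[Zhang2022LandauSiegel] — **an unrefereed manuscript under adjudication; every `def … : Prop` below
is a CLAIM OF THE MANUSCRIPT, STATED NOT ASSERTED**, except where a `_holds` theorem DISCHARGES it:

* `lemma56_holds` — **Lemma 5.6 (stated in the source without proof, "a weaker form of the
  Deuring–Heilbronn phenomenon") is a THEOREM of the tree** (`lemma56_printed`);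
* `lemma58_holds` — **Lemma 5.8 is a theorem of the tree** (`Lemma58.lemma_5_8_of_le`);
* `lemma55_holds_of` — **Lemma 5.5 (also stated without proof) follows from the named fact
  `deuring_heilbronn`** (Linnik's Deuring–Heilbronn phenomenon, unproved in the tree) via the
  tree's `lemma55_of_deuring_heilbronn` — a CONDITIONAL discharge; the real-simple-zero half is
  unconditional (`lemma55_exceptionalZero`).

(Lemma 5.7 is discharged in `SkeletonAssembly.lemma57_holds`.)

| node | locator | printed claim |
|---|---|---|
| `Lemma51` | §5 Lemma 5.1, (5.1)–(5.4) | `(Z(s+w,ψ) − Z(s,ψ)(pt₀)^{−w})/w ≪ 𝓛⁻¹¹⁴` etc. (`w = iv`, `|v| < 𝓛²⁰`) |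
| `Lemma52 c′` | §5 Lemma 5.2 | `Y(s+β₁)Y(s+β₂)Y(s+β₃)/Y(s) = (pt₀)^{β₃}Z(s,ψ)⁻¹(1 + O(𝓛⁻¹²³))` |
| `Lemma53`, `Lemma54` | §5 Lemmas 5.3, 5.4 | (5.8)–(5.9) for `Δ(x)`; `δ(s) ≪ 𝓛ᶜ|s|⁻²`, `δ(s) = 1 + O(α log 𝓛)` |
| `Lemma55` | §5 Lemma 5.5 | (A) ⇒ simple real zero `ρ̃`, `1 − ρ̃ = O(𝓛⁻²⁰²²)`, no other zero in `σ > 1 − 2𝓛⁻¹, |t| < 2D` |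
| `Lemma56` | §5 Lemma 5.6 | (A) ⇒ `Σ_{p∼P} θ(p)p^{1+it} ≪ 𝔓exp(−𝓛^{9/2})` (`θ ≠ χ` primitive mod `r < T`, `|t| ≤ D`) |
| `Lemma58` | §5 Lemma 5.8 | (A) ⇒ `L(s,χ) = L′(1,χ)(s−1) + O(𝓛⁻¹⁵)` for `α ≤ |s−1| ≤ 10α` |
| `Lemma59 c′` | §5 Lemma 5.9 | `ψ ∈ Ψ₁`, `s` at distance `≫ α` from the zeros ⇒ `L(s+β₁,ψ)/L(s,ψ) ≪ log P` |
| `Lemma61` | §6 Lemma 6.1 | `L(s,ψ) = K(s,ψ) + Z(s,ψ)N(1−s,ψ̄) + O(E₁(s,ψ))` |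

Objects: `DeltaW`, `deltaW` (the tree's `Lemma53.Delta57`, `Lemma53.delta514` at `𝓛₂, t₀`),
`gW`, `gstar` ((4.1), §6; the tree's `GaussWeight.gWeight` at `Λ = 𝓛³⁰`), `Kchar`, `Nchar`
(`K(s,θ)`, `N(w,θ)` for a coefficient character `θ ∈ {ψ, ψ̄}`), `E1main`.

## References

* Y. Zhang, arXiv:2211.02515v1 (2022), §5 pp. 10–11, §6 p. 12.
  [cite: Zhang2022LandauSiegel, §§5–6]
-/

noncomputable section

open Complex Real ComplexConjugate

namespace Literature.NumberTheory.LFunctions.Zhang2022.Skeleton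

/-! ## §5: Lemmas 5.1–5.6, 5.8, 5.9 -/

/-- The standing range of Lemmas 5.1–5.2: `|σ − 1/2| ≤ α`, `|t − 2πt₀| < 𝓛₁ + 2`.
[cite: Zhang2022LandauSiegel, §5 Lemma 5.1] -/
def InRange51 (D : ℕ) (s : ℂ) : Prop :=
  |s.re - 1 / 2| ≤ alpha D ∧ |s.im - 2 * π * t0 D| < ell1 D + 2

/-- **Lemma 5.1** (§5 p. 10), (5.1)–(5.4): for `ψ ∈ Ψ`, `s` in the range, `w = iv`, `|v| < 𝓛²⁰`
(`v ≠ 0`): `(Z(s+w,ψ) − Z(s,ψ)(pt₀)^{−w})/w ≪ 𝓛⁻¹¹⁴`, `… (Pt₀)^{−w} … ≪ 𝓛⁻⁶⁸`, and the same for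
`Z(·,ψχ)` with `Dpt₀`, `DPt₀`. CLAIM. [cite: Zhang2022LandauSiegel, §5 Lemma 5.1] -/
def Lemma51 : Prop :=
  ∃ C : ℝ, ForAllLarge fun D _ χ => ∀ x : Chr D, ∀ s : ℂ, InRange51 D s → ∀ v : ℝ, v ≠ 0 →
    |v| < ell D ^ 20 →
      ‖(GammaFactor.Zfac x.ψ (s + v * I) -
          GammaFactor.Zfac x.ψ s * (((x.p : ℝ) * t0 D : ℝ) : ℂ) ^ (-(v * I))) / (v * I)‖
        ≤ C * (ell D ^ 114)⁻¹ ∧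
      ‖(GammaFactor.Zfac x.ψ (s + v * I) -
          GammaFactor.Zfac x.ψ s * ((bigP D * t0 D : ℝ) : ℂ) ^ (-(v * I))) / (v * I)‖
        ≤ C * (ell D ^ 68)⁻¹ ∧
      ‖(Zpc χ x (s + v * I) - Zpc χ x s * (((D : ℝ) * x.p * t0 D : ℝ) : ℂ) ^ (-(v * I))) / (v * I)‖
        ≤ C * (ell D ^ 114)⁻¹ ∧
      ‖(Zpc χ x (s + v * I) - Zpc χ x s * (((D : ℝ) * bigP D * t0 D : ℝ) : ℂ) ^ (-(v * I))) /
          (v * I)‖ ≤ C * (ell D ^ 68)⁻¹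

/-- **Lemma 5.2** (§5 p. 10): for `ψ`, `s` as in Lemma 5.1,
"`Y(s+β₁,ψ)Y(s+β₂,ψ)Y(s+β₃,ψ)/Y(s,ψ) = (pt₀)^{β₃}Z(s,ψ)⁻¹(1 + O(𝓛⁻¹²³))`". CLAIM (the exact
version without the parameter bookkeeping is the tree's `GammaFactor.sqrt_inv_Zfac_triple_shift`).
[cite: Zhang2022LandauSiegel, §5 Lemma 5.2] -/
def Lemma52 (c' : ℝ) : Prop :=
  ∃ C : ℝ, ForAllLarge fun D _ _ => ∀ x : Chr D, ∀ s : ℂ, InRange51 D s →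
    ‖Yroot x.ψ (s + beta1 c' D) * Yroot x.ψ (s + beta2 c' D) * Yroot x.ψ (s + beta3 c' D) /
          Yroot x.ψ s -
        (((x.p : ℝ) * t0 D : ℝ) : ℂ) ^ beta3 c' D * (GammaFactor.Zfac x.ψ s)⁻¹‖
      ≤ C * (ell D ^ 123)⁻¹ * ‖(((x.p : ℝ) * t0 D : ℝ) : ℂ) ^ beta3 c' D * (GammaFactor.Zfac x.ψ s)⁻¹‖

/-- **`Δ(x)`** of (5.6)–(5.7) at the manuscript's parameters `𝓛₂, t₀` (the tree's `Lemma53.Delta57`).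
[cite: Zhang2022LandauSiegel, §5 (5.7)] -/
def DeltaW (D : ℕ) (x : ℝ) : ℂ := Lemma53.Delta57 (ell2 D) (t0 D) x

/-- **`δ(s) = ∫₀^∞ Δ(x)x^{s−1}dx`** (5.14) (the tree's `Lemma53.delta514`).
[cite: Zhang2022LandauSiegel, §5 (5.14)] -/
def deltaW (D : ℕ) (s : ℂ) : ℂ := Lemma53.delta514 (ell2 D) (t0 D) s

/-- **Lemma 5.3** (§5 p. 10): (5.8) "if `x ≤ t₀^{1.02}` then `Δ(x) = ω(1/2+2πix)(1 + O(α)) + O(ε)`"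
(`ε = exp{−c𝓛¹⁰}`) and (5.9) "if `x > t₀^{1.02}` then
`Δ(x) ≪ exp{−(10⁻²𝓛₂log x)²} + exp{−x^{0.99}/𝓛₂}`" (for `x > 0`). CLAIM.
[cite: Zhang2022LandauSiegel, §5 Lemma 5.3] -/
def Lemma53 : Prop :=
  ∃ c : ℝ, 0 < c ∧ ∃ C : ℝ, ForAllLarge fun D _ _ => ∀ x : ℝ, 0 < x →
    (x ≤ t0 D ^ (1.02 : ℝ) →
      ‖DeltaW D x - omegaW D (1 / 2 + 2 * π * x * I)‖
        ≤ C * alpha D * ‖omegaW D (1 / 2 + 2 * π * x * I)‖ + Real.exp (-c * ell D ^ 10)) ∧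
    (t0 D ^ (1.02 : ℝ) < x →
      ‖DeltaW D x‖ ≤ C * (Real.exp (-((1 : ℝ) / 100 * ell2 D * Real.log x) ^ 2) +
        Real.exp (-(x ^ (0.99 : ℝ)) / ell2 D)))

/-- **Lemma 5.4** (§5 p. 11): (i) "if `1/2 ≤ σ ≤ 2` then `δ(s) ≪ 𝓛ᶜ|s|⁻²`" (some absolute exponent
`c`); (ii) "if `|s − 1| < 10α` then `δ(s) = 1 + O(α log 𝓛)`". CLAIM.
[cite: Zhang2022LandauSiegel, §5 Lemma 5.4] -/
def Lemma54 : Prop :=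
  ∃ k : ℕ, ∃ C : ℝ, ForAllLarge fun D _ _ => ∀ s : ℂ,
    (1 / 2 ≤ s.re → s.re ≤ 2 → ‖deltaW D s‖ ≤ C * ell D ^ k * ‖s‖⁻¹ ^ 2) ∧
    (‖s - 1‖ < 10 * alpha D → ‖deltaW D s - 1‖ ≤ C * alpha D * Real.log (ell D))

/-- **Lemma 5.5** (§5 p. 11, under (A); stated without proof as "a weaker form of the
Deuring–Heilbronn phenomenon"): "`L(s,χ)` has a simple real zero `ρ̃` such that `1 − ρ̃ = O(𝓛⁻²⁰²²)`
and `L(s,χ)` has no other zeros in the region `σ > 1 − 2𝓛⁻¹`, `|t| < 2D`." CLAIM (real-zero part: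
tree `lemma55_exceptionalZero`; full: `lemma55_holds_of` below, CONDITIONAL on the named fact
`deuring_heilbronn` via the tree's `lemma55_of_deuring_heilbronn`).
[cite: Zhang2022LandauSiegel, §5 Lemma 5.5] -/
def Lemma55 : Prop :=
  ∃ C : ℝ, ForAllLarge fun D _ χ => AssumptionA D χ →
    ∃ ρt : ℝ, χ.LFunction ρt = 0 ∧ deriv χ.LFunction ρt ≠ 0 ∧ 0 ≤ 1 - ρt ∧
      1 - ρt ≤ C * (ell D ^ 2022)⁻¹ ∧
      ∀ s : ℂ, χ.LFunction s = 0 → 1 - 2 / ell D < s.re → |s.im| < 2 * D → s = ρt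

/-- **Lemma 5.5 from the Deuring–Heilbronn phenomenon**: the node `Lemma55` HOLDS conditionally on
the tree's named fact `deuring_heilbronn` (Linnik's repulsion; a published theorem not yet proved
in the tree), by `lemma55_of_deuring_heilbronn`; its real-simple-zero half is unconditional in the
tree (`lemma55_exceptionalZero`). [cite: Zhang2022LandauSiegel, §5 Lemma 5.5] -/
theorem lemma55_holds_of (hDH : deuring_heilbronn) : Lemma55 := by
  obtain ⟨D₀, K, -, h⟩ := lemma55_of_deuring_heilbronn hDH
  refine ⟨K, max D₀ 3, fun D _ χ hD hq hp hA => ?_⟩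
  have hD3 : 3 ≤ D := le_trans (le_max_right _ _) hD
  have hne1 : χ ≠ 1 := ne_one_of_isPrimitive_of_three_le hp hD3
  have hA' : ‖χ.LFunction 1‖ < (Real.log D ^ 2022)⁻¹ := by
    rw [← one_div]; exact hA
  obtain ⟨ρ, hρ1, hρ0, hder, hK, huniq⟩ := h D (le_trans (le_max_left _ _) hD) χ hne1 hA'
  refine ⟨ρ, hρ0, hder, by linarith, ?_, fun s hs hre him => huniq s hs ?_ him⟩
  · rw [ell]; exact hK
  · rw [ell] at hre; exact hre

/-- **Lemma 5.6** (§5 p. 11, under (A); stated without proof): "For any primitive character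
`θ (mod r)` with `r < T` and `θ ≠ χ`, `Σ_{p∼P} θ(p)p^{1+it} ≪ 𝔓exp{−𝓛^{9/2}}` if `|t| ≤ D`"
(`1 < r`; "`θ ≠ χ`" as characters mod `Dr`). CLAIM — and a THEOREM of the tree (`lemma56_holds`).
[cite: Zhang2022LandauSiegel, §5 Lemma 5.6] -/
def Lemma56 : Prop :=
  ∃ C : ℝ, ForAllLarge fun D _ χ => AssumptionA D χ →
    ∀ (r : ℕ) [NeZero r], 1 < r → (r : ℝ) < bigT D →
      ∀ θ : DirichletCharacter ℂ r, θ.IsPrimitive →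
        DirichletCharacter.changeLevel (Nat.dvd_mul_left r D) θ ≠
          DirichletCharacter.changeLevel (Nat.dvd_mul_right D r) χ →
        ∀ t : ℝ, |t| ≤ D →
          ‖∑ p ∈ primeWindow D, θ p * (p : ℂ) ^ (1 + t * I)‖ ≤
            C * frakP D * Real.exp (-(ell D ^ ((9 : ℝ) / 2)))

/-- **Lemma 5.6 is a theorem of the tree**: the node `Lemma56` HOLDS, by `lemma56_printed`
(Montgomery–Vaughan Chs. 6, 10–12, Linnik, Bombieri's *grand crible*, all proved in the tree).
[cite: Zhang2022LandauSiegel, §5 Lemma 5.6] -/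
theorem lemma56_holds : Lemma56 := by
  obtain ⟨D₀, C, -, h⟩ := lemma56_printed
  refine ⟨C, max D₀ 3, fun D _ χ hD hq hp hA r _ hr hrT θ hθ hne t ht => ?_⟩
  have hD3 : 3 ≤ D := le_trans (le_max_right _ _) hD
  have hne1 : χ ≠ 1 := ne_one_of_isPrimitive_of_three_le hp hD3
  have hA' : ‖χ.LFunction 1‖ < (Real.log D ^ 2022)⁻¹ := by
    rw [← one_div]; exact hA
  have hT : (r : ℝ) < Real.exp (Real.log D ^ ((11 : ℝ) / 10)) := by
    rw [bigT, ell] at hrT; norm_num at hrT ⊢; exact hrT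
  exact h D (le_trans (le_max_left _ _) hD) χ hne1 hA' r hr hT θ hθ hne t ht

/-- `Lemma56` — `_holds` alias of `lemma56_holds` above under the fact's exact name (appended
2026-08-28, D-0026 bookkeeping: the proof term is the existing theorem of this file; no statement,
definition or attribute is edited; no new named fact; the ledger's debt table listed the fact
unproved). [cite: Zhang2022LandauSiegel, §5 Lemma 5.6] -/
theorem _root_.Literature.NumberTheory.LFunctions.Zhang2022.Skeleton.Lemma56_holds : Lemma56 :=
  _root_.Literature.NumberTheory.LFunctions.Zhang2022.Skeleton.lemma56_holds

/-- **Lemma 5.8** (§5 p. 11, under (A)): "If `α ≤ |s − 1| ≤ 10α` then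
`L(s,χ) = L′(1,χ)(s − 1) + O(α₂)`, `α₂ = 𝓛⁻¹⁵`." CLAIM — and a THEOREM of the tree
(`lemma58_holds`). [cite: Zhang2022LandauSiegel, §5 Lemma 5.8] -/
def Lemma58 : Prop :=
  ∃ C : ℝ, ForAllLarge fun D _ χ => AssumptionA D χ → ∀ s : ℂ,
    alpha D ≤ ‖s - 1‖ → ‖s - 1‖ ≤ 10 * alpha D →
      ‖χ.LFunction s - deriv χ.LFunction 1 * (s - 1)‖ ≤ C * (ell D ^ 15)⁻¹

/-- **Lemma 5.8 is a theorem of the tree**: the node `Lemma58` HOLDS, by `Lemma58.lemma_5_8_of_le`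
with `K = 10` (`α = π/log P = π𝓛⁻⁹`; `10π ≤ 𝓛⁸` once `log D ≥ 3`).
[cite: Zhang2022LandauSiegel, §5 Lemma 5.8] -/
theorem lemma58_holds : Lemma58 := by
  refine ⟨1 + 16 * Real.exp (9 / 2) * π ^ 2 * 10 ^ 2, ⌈Real.exp 3⌉₊,
    fun D _ χ hD hq hp hA s _ hs => ?_⟩
  have hlog : 3 ≤ Real.log D := by
    have h : Real.exp 3 ≤ D := le_trans (Nat.le_ceil _) (by exact_mod_cast hD)
    exact (Real.le_log_iff_exp_le (lt_of_lt_of_le (Real.exp_pos _) h)).mpr h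
  have hα : alpha D = π / Real.log D ^ 9 := by rw [alpha, bigP, Real.log_exp, ell]
  have hKL : 10 * π ≤ Real.log D ^ 8 := by
    have hπ : π < 4 := Real.pi_lt_four
    calc 10 * π ≤ 3 ^ 8 := by nlinarith
      _ ≤ Real.log D ^ 8 := by gcongr
  have hs' : ‖s - 1‖ ≤ 10 * π / Real.log D ^ 9 := by rw [mul_div_assoc, ← hα]; exact hs
  have h := Lemma58.lemma_5_8_of_le χ hp hlog (le_of_lt hA) hKL hs'
  rw [ell, ← one_div, mul_one_div]
  exact h

/-- `Lemma58` — `_holds` alias of `lemma58_holds` above under the fact's exact name (appended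
2026-08-28, D-0026 bookkeeping: the proof term is the existing theorem of this file; no statement,
definition or attribute is edited; no new named fact; the ledger's debt table listed the fact
unproved). [cite: Zhang2022LandauSiegel, §5 Lemma 5.8] -/
theorem _root_.Literature.NumberTheory.LFunctions.Zhang2022.Skeleton.Lemma58_holds : Lemma58 :=
  _root_.Literature.NumberTheory.LFunctions.Zhang2022.Skeleton.lemma58_holds

/-- **Lemma 5.9** (§5 p. 11): "Suppose `ψ ∈ Ψ₁`, `|σ − 1/2| ≤ α`, `|t − 2πt₀| ≤ 𝓛₁ + 10` and
`|s − ρ| ≫ α` for any zero `ρ` of `L(s,ψ)`. Then `L(s+β₁,ψ)/L(s,ψ) ≪ log P`" (the implied constant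
depending on that of `≫`). CLAIM. [cite: Zhang2022LandauSiegel, §5 Lemma 5.9] -/
def Lemma59 (c' : ℝ) : Prop :=
  ∀ c₀ : ℝ, 0 < c₀ → ∃ C : ℝ, ForAllLarge fun D _ χ => ∀ x ∈ PsiOne χ, ∀ s : ℂ,
    |s.re - 1 / 2| ≤ alpha D → |s.im - 2 * π * t0 D| ≤ ell1 D + 10 →
      (∀ ρ : ℂ, x.ψ.LFunction ρ = 0 → c₀ * alpha D ≤ ‖s - ρ‖) →
        ‖x.ψ.LFunction (s + beta1 c' D) / x.ψ.LFunction s‖ ≤ C * Real.log (bigP D)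

/-! ## §6: `g`, `g*`, `K`, `N`, `E₁` and Lemma 6.1 -/

/-- **`g(x)`** (4.1): `(1/√π)∫_{−∞}^{𝓛¹⁵log x} e^{−t²}dt` (the tree's `GaussWeight.gWeight` at
`Λ = 𝓛³⁰`, cf. `GaussWeight.gWeight_eq_erf_form`). [cite: Zhang2022LandauSiegel, §4 (4.1)] -/
def gW (D : ℕ) (y : ℝ) : ℝ := GaussWeight.gWeight (ell D ^ 30) y

/-- **`g*(y)`** (§6 p. 12): `g(y)` if `y > 1/2`, `0` otherwise. [cite: Zhang2022LandauSiegel, §6 p. 12] -/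
def gstar (D : ℕ) (y : ℝ) : ℝ := if 1 / 2 < y then gW D y else 0

variable {D : ℕ} (x : Chr D)

/-- **`K(s,θ) = Σ_n θ(n)n^{−s}g*(P₄/n)`** for a coefficient character `θ` (`= ψ` in Lemma 6.1,
`= ψ̄` in (13.3)–(13.5)); a finite sum, `g*(P₄/n) = 0` for `n ≥ 2P₄`.
[cite: Zhang2022LandauSiegel, §6 Lemma 6.1] -/
def Kchar (D : ℕ) (θ : ℕ → ℂ) (s : ℂ) : ℂ :=
  ∑ n ∈ Finset.Ico 1 ⌈2 * P4 D⌉₊, θ n * (n : ℂ) ^ (-s) * (gstar D (P4 D / n) : ℂ)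

/-- **`N(w,θ) = Σ_n θ(n)n^{−w}g*(T²/n)`** (`θ = ψ̄`, `w = 1 − s` in Lemma 6.1; `θ = ψ` in
(13.2)–(13.6)); a finite sum, `n < 2T²`. [cite: Zhang2022LandauSiegel, §6 Lemma 6.1] -/
def Nchar (D : ℕ) (θ : ℕ → ℂ) (w : ℂ) : ℂ :=
  ∑ n ∈ Finset.Ico 1 ⌈2 * bigT D ^ 2⌉₊, θ n * (n : ℂ) ^ (-w) * (gstar D (bigT D ^ 2 / n) : ℂ)

/-- The coefficient character `n ↦ ψ(n)`. [cite: Zhang2022LandauSiegel, §6 Lemma 6.1] -/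
def psiFn : ℕ → ℂ := fun n => x.ψ (n : ZMod x.p)

/-- The conjugate coefficient character `n ↦ ψ̄(n)`. [cite: Zhang2022LandauSiegel, §6 Lemma 6.1] -/
def psiBarFn : ℕ → ℂ := fun n => conj (x.ψ (n : ZMod x.p))

/-- The main part of **`E₁(s,ψ)`** (Lemma 6.1):
`𝓛⁻⁶⁸∫_{−𝓛²⁰}^{𝓛²⁰} |Σ_{n<T³} ψ(n)n^{−(s+iv)}| ω₁(iv)dv`, `ω₁(iv) = exp(−v²/(4𝓛³⁰))` (§4 p. 8);
the printed `E₁` adds `ε = exp{−c𝓛¹⁰}`. [cite: Zhang2022LandauSiegel, §6 Lemma 6.1] -/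
def E1main (s : ℂ) : ℝ :=
  (ell D ^ 68)⁻¹ * ∫ v in (-(ell D ^ 20))..(ell D ^ 20),
    ‖∑ n ∈ Finset.Ico 1 ⌈bigT D ^ 3⌉₊, x.ψ (n : ZMod x.p) * (n : ℂ) ^ (-(s + v * I))‖ *
      Real.exp (-(v ^ 2) / (4 * ell D ^ 30))

/-- **Lemma 6.1** (§6 p. 12, the approximate formula for `L(s,ψ)`): for `ψ ∈ Ψ`,
`|σ − 1/2| < 2α`, `|t − 2πt₀| < 𝓛₁ + 2`: "`L(s,ψ) = K(s,ψ) + Z(s,ψ)N(1−s,ψ̄) + O(E₁(s,ψ))`".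
CLAIM. [cite: Zhang2022LandauSiegel, §6 Lemma 6.1] -/
def Lemma61 : Prop :=
  ∃ c : ℝ, 0 < c ∧ ∃ C : ℝ, ForAllLarge fun D _ _ => ∀ x : Chr D, ∀ s : ℂ,
    |s.re - 1 / 2| < 2 * alpha D → |s.im - 2 * π * t0 D| < ell1 D + 2 →
      ‖x.ψ.LFunction s - Kchar D (psiFn x) s -
          GammaFactor.Zfac x.ψ s * Nchar D (psiBarFn x) (1 - s)‖
        ≤ C * (E1main x s + Real.exp (-c * ell D ^ 10))

end Literature.NumberTheory.LFunctions.Zhang2022.Skeleton
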